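import Summits.NavierStokesRegularity.NavierStokesRegularity.Theses.SymmetryModuliCount
import Literature.Analysis.FluidPDE.PineauVicolRSS
import Literature.Analysis.FluidPDE.KNSSLiouville

/-!
# Sketch (crux-ideate, ideator 2): first lemmas of two levers on `SymmetricLiouville`

Lever A — blow-down kills the pitch: periodic (hence helical / translation-invariant) elements of
the Type-I KNSS-mild ancient class `𝒜_C` vanish.
Lever B — far-field recentring + Oseen bootstrap: elements of `𝒜_C` with a rotation or spiral-scaling
symmetry obey the critical rate `1/dist` away from the fixed set of the symmetry (KNSS Thm 5.3
hypothesis `|u| ≤ K/r`, resp. Pineau–Vicol's space–time Type-I bound (1.10)).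
Nothing is proved here; the statements must elaborate.
-/

namespace Summit.NavierStokesRegularity.NavierStokesRegularity.Cruxes.SymmetricLiouville.Ideator2

open Literature.Analysis.FluidPDE

local notation "ℝ³" => EuclideanSpace ℝ (Fin 3)

/-- The class `𝒜_C` of the route (verbatim hypothesis block of `SymmetricLiouville`). -/
def InClassA (C : ℝ) (u : ℝ → ℝ³ → ℝ³) : Prop :=
  ContDiffOn ℝ (⊤ : ℕ∞) (Function.uncurry u) (Set.Iio 0 ×ˢ Set.univ) ∧
  (∀ t < 0, VectorCalculus.IsDivFree (u t)) ∧
  (∀ s t : ℝ, s < t → t < 0 → ∀ x, u t x = heatFlow (u s) (t - s) x -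
      ∫ τ in Set.Ioo s t, ∫ y, oseenKernel (t - τ) (x - y) (u τ y) (u τ y)) ∧
  HasTypeITimeDecay C u

/-! ## Lever A -/

/-- A1 (blow-down vanishing at `t → −∞`): an element of `𝒜_C` which is periodic in some direction has
`√(−t) ‖u(t)‖_∞ → 0` as `t → −∞` (blow-down limits are `e`-independent, hence 2.5-D, hence zero). -/
def PeriodicBlowdownVanishing : Prop :=
  ∀ (C : ℝ) (u : ℝ → ℝ³ → ℝ³), InClassA C u →
    (∃ e : ℝ³, e ≠ 0 ∧ ∀ t < 0, ∀ x, u t (x + e) = u t x) →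
    ∀ ε > 0, ∃ T < 0, ∀ t < T, ∀ x, Real.sqrt (-t) * ‖u t x‖ ≤ ε

/-- A2 (small at `−∞` ⇒ zero; the absorption step, valid for EVERY element of `𝒜_C`): the mild identity
from `s → −∞` and the `L¹` bound `c/√t` on the Oseen kernel give `N(t) ≤ cπ (sup_{τ≤t} N)²`. -/
def SmallAtMinusInfinityLiouville : Prop :=
  ∀ (C : ℝ) (u : ℝ → ℝ³ → ℝ³), InClassA C u →
    (∀ ε > 0, ∃ T < 0, ∀ t < T, ∀ x, Real.sqrt (-t) * ‖u t x‖ ≤ ε) →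
    ∀ t < 0, ∀ x, u t x = 0

/-- A (first lemma of the line, = A1 + A2): periodic elements of `𝒜_C` vanish. Covers the screw
(helical, any pitch `h ≠ 0`: period `2π|h|` along the axis) and translation leaves of `SymmetricLiouville`. -/
def PeriodicTypeIAncientLiouville : Prop :=
  ∀ (C : ℝ) (u : ℝ → ℝ³ → ℝ³), InClassA C u →
    (∃ e : ℝ³, e ≠ 0 ∧ ∀ t < 0, ∀ x, u t (x + e) = u t x) →
    ∀ t < 0, ∀ x, u t x = 0

theorem periodicTypeIAncientLiouville_of (h1 : PeriodicBlowdownVanishing)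
    (h2 : SmallAtMinusInfinityLiouville) : PeriodicTypeIAncientLiouville :=
  fun C u hu hper => h2 C u hu (h1 C u hu hper)

/-- The screw-invariant (helical) leaf is periodic along the axis: if `L_ξ u = 0` for
`ξ = (h e₃, 0, J)` (rotation about `e₃` plus axial drift `h ≠ 0`), then `u(t, x + 2πh e₃) = u(t, x)`.
Stated with the route's generator (`σ = 0`, `A = J`). Elementary ODE along the group orbit. -/
def HelicalIsPeriodic : Prop :=
  ∀ (u : ℝ → ℝ³ → ℝ³) (h : ℝ) (A : ℝ³ →L[ℝ] ℝ³), h ≠ 0 →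
    (∀ x : ℝ³, A x = rotZ (Real.pi / 2) x - (x 2) • EuclideanSpace.single (2 : Fin 3) (1 : ℝ)) →
    ContDiffOn ℝ (⊤ : ℕ∞) (Function.uncurry u) (Set.Iio 0 ×ˢ Set.univ) →
    (∀ t < 0, ∀ x, fderiv ℝ (u t) x (h • EuclideanSpace.single (2 : Fin 3) (1 : ℝ) + A x) - A (u t x) = 0) →
    ∀ t < 0, ∀ x, u t (x + (2 * Real.pi * h) • EuclideanSpace.single (2 : Fin 3) (1 : ℝ)) = u t x

/-! ## Lever B -/

/-- B1 (far-field vanishing, qualitative, uniform over the class): for elements of `𝒜_C` annihilated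
by a generator with `a = 0` and (`σ ≠ 0` or `A ≠ 0`) — a spiral scaling or a rotation about an axis
through the origin — the scale-invariant size `√(−t)|u|` is small far from the fixed set
`{x : σx + Ax = 0}` measured in units of `√(−t)`: recentred limits at far points inherit a
translation symmetry and die by the planar Liouville theorem. -/
def FarFieldVanishing : Prop :=
  ∀ (C : ℝ), ∀ ε > 0, ∃ ρ : ℝ, ∀ (u : ℝ → ℝ³ → ℝ³) (σ : ℝ) (A : ℝ³ →L[ℝ] ℝ³),
    InClassA C u → (∀ x, inner ℝ (A x) x = 0) → ¬ (σ = 0 ∧ A = 0) →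
    (∀ t < 0, ∀ x, fderiv ℝ (u t) x (σ • x + A x) + σ • u t x +
        (2 * σ * t) • timeDeriv u t x - A (u t x) = 0) →
    ∀ t < 0, ∀ x, ρ * Real.sqrt (-t) * (|σ| + ‖A‖) ≤ ‖σ • x + A x‖ →
      Real.sqrt (-t) * ‖u t x‖ ≤ ε

/-- B2 (Oseen far-field bootstrap ⇒ critical rate), axisymmetric case: an axisymmetric element of
`𝒜_C` obeys `r |u| ≤ K(C)` — exactly the hypothesis of KNSS 2009 Thm 5.3
(`KNSS2009_liouville_bound_C_over_r`). -/
def AxisymmetricAxisRate : Prop :=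
  ∀ (C : ℝ), ∃ K : ℝ, ∀ (u : ℝ → ℝ³ → ℝ³), InClassA C u →
    (∀ t < 0, ∀ θ x, u t (rotZ θ x) = rotZ θ (u t x)) →
    ∀ t < 0, ∀ x, cylRadius x * ‖u t x‖ ≤ K

/-- B2, spiral-scaling (RSS) case: an element of `𝒜_C` invariant under a spiral scaling about the
origin obeys Pineau–Vicol's space–time Type-I bound (1.10) `|u| ≤ K(C)/(|x| + √(−t))`
(`HasTypeIDecay`), with `K` depending on `C` only; so `pineauVicol2026_rss_liouville` applies. -/
def SpiralScalingSpaceTimeRate : Prop :=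
  ∀ (C : ℝ), ∃ K : ℝ, ∀ (u : ℝ → ℝ³ → ℝ³) (σ : ℝ) (A : ℝ³ →L[ℝ] ℝ³),
    InClassA C u → (∀ x, inner ℝ (A x) x = 0) → σ ≠ 0 →
    (∀ t < 0, ∀ x, fderiv ℝ (u t) x (σ • x + A x) + σ • u t x +
        (2 * σ * t) • timeDeriv u t x - A (u t x) = 0) →
    HasTypeIDecay K u

/-- The rotation leaf then closes by KNSS Thm 5.3 (named fact, architecture in tree). -/
def AxisymmetricLeaf : Prop :=
  ∀ (C : ℝ) (u : ℝ → ℝ³ → ℝ³), InClassA C u →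
    (∀ t < 0, ∀ θ x, u t (rotZ θ x) = rotZ θ (u t x)) →
    ∀ t < 0, ∀ x, u t x = 0

end Summit.NavierStokesRegularity.NavierStokesRegularity.Cruxes.SymmetricLiouville.Ideator2
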